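import Summits.BirchSwinnertonDyer.BirchSwinnertonDyer.Theorems.KolyvaginRankRigidityAtTwoChebotarevOneClassAtTwoShifted
import HarnessLib

/-!
# Crux V2♭ `KolyvaginCorankLowerBoundAtTwo` (stmt-BirchSwinnertonDyer-24623), line `kolyvagin_depth_split`,
# stub T5⁺, window step T5b: Čebotarev at `2` for TWO eigenclasses SIMULTANEOUSLY, one level up
# (helper, PROVED, unconditional; width seat `bsd-line-krr2-p2` g6)

Kolyvagin's window replacement (McCallum 1991, proof of Prop. 5.2; Kolyvagin [LNM 1479] Prop. 8)
chooses the new prime `ℓ'` by Čebotarev so that `φ_{Frob λ'}(c(n)) ≠ 0` AND `φ_{Frob λ'}(c) ≠ 0` for an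
auxiliary class `c`; at odd `p` the two classes lie in different `τ`-eigenspaces, which makes the
pair independent. At `2` eigenspaces do not separate, but for TWO classes nothing is needed: the
elements of `Γ_{K(E[2^{M'}])}` at which `[κ_i, (·)^τ(·)]` is small form a subgroup `Z_i`, proper by
Step B′ (`exists_mem_torsionFixing_eigenvalue_large`), and a group is not the union of two proper
subgroups (`exists_not_mem_and_not_mem`). Hence

* `exists_kolyvaginPrime_gt_two_eigenclass_pair_of_le` — for `κ₁, κ₂ ∈ H¹(K, E[2^M])` with
  `c_* κ_i = ε_i κ_i`, `2^{m_i-1} κ_i ≠ 0` (no independence, `κ₁ = κ₂` allowed), `M ≤ M'`: above every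
  bound a Kolyvagin prime `ℓ` at `2` with `M' ≤ M(ℓ)` at whose place BOTH `2^j κ₁` (`j + 3 ≤ m₁`) and
  `2^j κ₂` (`j + 3 ≤ m₂`) are not locally trivial. Both signs of `Δ_E`; unconditional.

(Three or more classes DO need an independence input — the Klein four-group is a union of three
proper subgroups; that is the `τ`-stable-family theorem of GK2 with its `hres` binder.)
HONEST FRAMING: helper (`--supports` 24623) for the Čebotarev half of the window step; the duality
half (existence of the auxiliary class with prescribed local conditions and large order, McCallum
Lemma 5.3 / Prop. 2.1 at `2`, and the reciprocity law Prop. 2.2) is NOT touched; T5⁺ and V2♭ are NOT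
proved; BSD is not proved by any of this.

References: [McCallumLMS1991] §5 (proof of Prop. 5.2), §3 Cor. 3.2; [Kolyvagin1991MathAnn] §2
(ref. [1] Prop. 8); [WZhang2014] Notations (xii).
-/

set_option autoImplicit false
-- the Theorems namespace of this sub repeats the summit name by design (D-0017 nested layout)
set_option linter.dupNamespace false

noncomputable section

open scoped Classical Pointwise

namespace Summit.BirchSwinnertonDyer.BirchSwinnertonDyer.Theorems.KolyvaginLowerBoundAtTwo

open WeierstrassCurve Field NumberField IsDedekindDomain
open Literature.NumberTheory.GaloisRepresentations Literature.NumberTheory.EllipticCurves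
open Literature.NumberTheory Rat.HeightOneSpectrum

universe u

section Pair

variable {W : WeierstrassCurve ℚ}

/-! ### Two eigenclasses at once (no independence needed) -/

/-- A group is not the union of two proper subgroups: given elements outside each of two subgroups,
some element lies outside both. [folklore] -/
theorem exists_not_mem_and_not_mem {G : Type*} [Group G] {Z₁ Z₂ : Subgroup G} {H : Subgroup G}
    (h₁ : ∃ g ∈ H, g ∉ Z₁) (h₂ : ∃ g ∈ H, g ∉ Z₂) : ∃ g ∈ H, g ∉ Z₁ ∧ g ∉ Z₂ := by
  obtain ⟨g₁, hg₁H, hg₁⟩ := h₁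
  obtain ⟨g₂, hg₂H, hg₂⟩ := h₂
  by_cases h12 : g₁ ∈ Z₂
  · by_cases h21 : g₂ ∈ Z₁
    · refine ⟨g₁ * g₂, H.mul_mem hg₁H hg₂H, fun h ↦ hg₁ ?_, fun h ↦ hg₂ ?_⟩
      · have := Z₁.mul_mem h (Z₁.inv_mem h21)
        rwa [mul_inv_cancel_right] at this
      · have := Z₂.mul_mem (Z₂.inv_mem h12) h
        rwa [inv_mul_cancel_left] at this
    · exact ⟨g₂, hg₂H, h21, hg₂⟩
  · exact ⟨g₁, hg₁H, hg₁, h12⟩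

set_option maxHeartbeats 800000 in
/-- **Čebotarev at `2` for TWO eigenclasses simultaneously, one level up** (the shape used in
Kolyvagin's window replacement, McCallum's proof of Prop. 5.2: one prime `ℓ'` with
`φ_{Frob}(c(n)) ≠ 0` AND `φ_{Frob}(c) ≠ 0` for an auxiliary class `c`; at odd `p` this uses that the
two classes lie in different eigenspaces, at `2` NO independence or eigen-separation is needed —
a group is not the union of two proper subgroups). For `κ₁, κ₂ ∈ H¹(K, E[2^M])`, `c_* κ_i = ε_i κ_i`,
`2^{m_i - 1} κ_i ≠ 0`, `M ≤ M'`: above every bound a Kolyvagin prime `ℓ` at `2` with `M' ≤ M(ℓ)` at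
whose place BOTH `2^j κ₁` (`j + 3 ≤ m₁`) and `2^j κ₂` (`j + 3 ≤ m₂`) are not locally trivial.
[cite: McCallumLMS1991, §5 (proof of Prop. 5.2), §3 Cor. 3.2] [cite: Kolyvagin1991MathAnn, §2
(ref. [1] Prop. 8)] -/
theorem exists_kolyvaginPrime_gt_two_eigenclass_pair_of_le {N : ℕ} [NeZero N] [W.IsElliptic]
    [W.IsGloballyMinimal] {K : Type} [Field K] [NumberField K] (hK : IsImaginaryQuadratic K)
    (hns : ¬ IsSquare ((NumberField.discr K : ℚ) * W.Δ))
    (hρ : ∀ n : ℕ, W.HasSurjectiveModNGaloisRep (2 ^ n : ℕ)) {c : K ≃ₐ[ℚ] K} (hc : c ≠ 1)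
    {M M' : ℕ} (hM : 1 ≤ M) (hMM' : M ≤ M')
    (κ₁ κ₂ : galH1Torsion (W.baseChange K) ((2 ^ M : ℕ) : ℤ))
    {ε₁ ε₂ : ℤ} (hε₁ : ε₁ = 1 ∨ ε₁ = -1) (hε₂ : ε₂ = 1 ∨ ε₂ = -1)
    (hκ₁ : conjAct W c ((2 ^ M : ℕ) : ℤ) κ₁ = ε₁ • κ₁)
    (hκ₂ : conjAct W c ((2 ^ M : ℕ) : ℤ) κ₂ = ε₂ • κ₂)
    {m₁ m₂ : ℕ} (hm₁ : (2 : ℤ) ^ (m₁ - 1) • κ₁ ≠ 0) (hm₂ : (2 : ℤ) ^ (m₂ - 1) • κ₂ ≠ 0) (b : ℕ) :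
    ∃ ℓ : ℕ, b < ℓ ∧ Zhang2014.IsKolyvaginPrime N W K 2 ℓ ∧ M' ≤ Zhang2014.kolyvaginIndex W 2 ℓ ∧
      FrobEqFrobInfty W K (2 ^ M') ℓ ∧
      ∀ v : HeightOneSpectrum (𝓞 K), (ℓ : 𝓞 K) ∈ v.asIdeal →
        (∀ j : ℕ, j + 3 ≤ m₁ → ((2 ^ j : ℕ) : ℤ) • κ₁ ∉
          (W.baseChange K).torsionLocalKer (v.adicCompletion K) ((2 ^ M : ℕ) : ℤ)) ∧
        (∀ j : ℕ, j + 3 ≤ m₂ → ((2 ^ j : ℕ) : ℤ) • κ₂ ∉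
          (W.baseChange K).torsionLocalKer (v.adicCompletion K) ((2 ^ M : ℕ) : ℤ)) := by
  classical
  have hp : Nat.Prime 2 := Nat.prime_two
  haveI : Fact (Nat.Prime 2) := ⟨hp⟩
  have hM' : 1 ≤ M' := hM.trans hMM'
  have hdvdMM' : ((2 ^ M : ℕ) : ℤ) ∣ ((2 ^ M' : ℕ) : ℤ) := by exact_mod_cast Nat.pow_dvd_pow 2 hMM'
  have hle := torsionFixing_le_of_dvd (W.baseChange K) hdvdMM'
  obtain ⟨c₀, hc₀⟩ := exists_isComplexConjugation (Rat.castHom ℝ)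
  have ht : IsLiftOfAut c (absGaloisTransport (K := ℚ) (L := K) c₀).toRingEquiv :=
    RatClosure.isLiftOfAut_absGaloisTransport_of_isImaginaryQuadratic hK hc hc₀
  have hinv : ∀ x, (absGaloisTransport (K := ℚ) (L := K) c₀).toRingEquiv
      ((absGaloisTransport (K := ℚ) (L := K) c₀).toRingEquiv x) = x := fun x ↦
    RatClosure.absGaloisTransport_absGaloisTransport_of_sq_eq_one hc₀.sq_eq_one x
  set G := torsionFixing (W.baseChange K) ((2 ^ M' : ℕ) : ℤ) with hG
  -- the "bad" subgroups `Z_i = {g : 2^{m_i - 3}(ε_i τ[κ_i, g] + [κ_i, g]) = 0}` of `Γ_{K(E[2^M])}`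
  have hZ : ∀ (κ : galH1Torsion (W.baseChange K) ((2 ^ M : ℕ) : ℤ)) (ε : ℤ) (k : ℕ),
      ∃ Z : Subgroup (absoluteGaloisGroup K), ∀ g ∈ torsionFixing (W.baseChange K) ((2 ^ M : ℕ) : ℤ),
        g ∈ Z ↔ (2 : ℤ) ^ k • (ε • ht.torsionMap W ((2 ^ M : ℕ) : ℤ) (h1Eval (W.baseChange K) ((2 ^ M : ℕ) : ℤ) κ g) +
          h1Eval (W.baseChange K) ((2 ^ M : ℕ) : ℤ) κ g) = 0 := by
    intro κ ε k
    -- the homomorphism `g ↦ 2^k (ε τ[κ,g] + [κ,g])` on `Γ_{K(E[2^M])}`, extended by junk outside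
    let f : absoluteGaloisGroup K → geomTorsion (W.baseChange K) ((2 ^ M : ℕ) : ℤ) := fun g ↦
      (2 : ℤ) ^ k • (ε • ht.torsionMap W ((2 ^ M : ℕ) : ℤ) (h1Eval (W.baseChange K) ((2 ^ M : ℕ) : ℤ) κ g) +
        h1Eval (W.baseChange K) ((2 ^ M : ℕ) : ℤ) κ g)
    have hf_mul : ∀ g₁ ∈ torsionFixing (W.baseChange K) ((2 ^ M : ℕ) : ℤ), ∀ g₂, f (g₁ * g₂) = f g₁ + f g₂ := by
      intro g₁ hg₁ g₂
      simp only [f, h1Eval_mul _ _ κ hg₁ g₂, map_add, smul_add]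
      abel
    have hf_one : f 1 = 0 := by simp only [f, h1Eval_one, map_zero, smul_zero, add_zero]
    refine ⟨{ carrier := {g | g ∈ torsionFixing (W.baseChange K) ((2 ^ M : ℕ) : ℤ) ∧ f g = 0}
              mul_mem' := fun {a b} ha hb ↦ ⟨mul_mem ha.1 hb.1, by rw [hf_mul a ha.1 b, ha.2, hb.2, add_zero]⟩
              one_mem' := ⟨Subgroup.one_mem _, hf_one⟩
              inv_mem' := fun {a} ha ↦ ⟨inv_mem ha.1, by
                have h := hf_mul a ha.1 a⁻¹
                rw [mul_inv_cancel, hf_one, ha.2, zero_add] at h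
                exact h.symm⟩ }, fun g hg ↦ ⟨fun h ↦ h.2, fun h ↦ ⟨hg, h⟩⟩⟩
  obtain ⟨Z₁, hZ₁⟩ := hZ κ₁ ε₁ (m₁ - 3)
  obtain ⟨Z₂, hZ₂⟩ := hZ κ₂ ε₂ (m₂ - 3)
  -- Step B′ for each class gives an element of `G` outside `Z_i` (when `m_i ≥ 3`)
  have hout : ∀ (κ : galH1Torsion (W.baseChange K) ((2 ^ M : ℕ) : ℤ)) (ε : ℤ) (hε : ε = 1 ∨ ε = -1)
      (hκ : conjAct W c ((2 ^ M : ℕ) : ℤ) κ = ε • κ) (m : ℕ) (hm : (2 : ℤ) ^ (m - 1) • κ ≠ 0)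
      (Z : Subgroup (absoluteGaloisGroup K)),
      (∀ g ∈ torsionFixing (W.baseChange K) ((2 ^ M : ℕ) : ℤ), g ∈ Z ↔ (2 : ℤ) ^ (m - 3) •
        (ε • ht.torsionMap W ((2 ^ M : ℕ) : ℤ) (h1Eval (W.baseChange K) ((2 ^ M : ℕ) : ℤ) κ g) + h1Eval (W.baseChange K) ((2 ^ M : ℕ) : ℤ) κ g) = 0) →
      3 ≤ m → ∃ g ∈ G, g ∉ Z := by
    intro κ ε hε hκ m hm Z hZ hm3
    obtain ⟨ρ, hρT, hρv⟩ :=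
      exists_mem_torsionFixing_eigenvalue_large hK hns hρ hc₀ ht hM hMM' κ hε hm
    exact ⟨ρ, hρT, fun h ↦ hρv (m - 3) (by omega) ((hZ ρ (hle hρT)).mp h)⟩
  -- choose `ρ ∈ G` outside the relevant `Z_i`
  have hρex : ∃ ρ ∈ G, (3 ≤ m₁ → ρ ∉ Z₁) ∧ (3 ≤ m₂ → ρ ∉ Z₂) := by
    by_cases h1 : 3 ≤ m₁
    · by_cases h2 : 3 ≤ m₂
      · obtain ⟨g, hgG, hg1, hg2⟩ := exists_not_mem_and_not_mem (H := G)
          (hout κ₁ ε₁ hε₁ hκ₁ m₁ hm₁ Z₁ hZ₁ h1) (hout κ₂ ε₂ hε₂ hκ₂ m₂ hm₂ Z₂ hZ₂ h2)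
        exact ⟨g, hgG, fun _ ↦ hg1, fun _ ↦ hg2⟩
      · obtain ⟨g, hgG, hg1⟩ := hout κ₁ ε₁ hε₁ hκ₁ m₁ hm₁ Z₁ hZ₁ h1
        exact ⟨g, hgG, fun _ ↦ hg1, fun h ↦ absurd h h2⟩
    · by_cases h2 : 3 ≤ m₂
      · obtain ⟨g, hgG, hg2⟩ := hout κ₂ ε₂ hε₂ hκ₂ m₂ hm₂ Z₂ hZ₂ h2
        exact ⟨g, hgG, fun h ↦ absurd h h1, fun _ ↦ hg2⟩
      · exact ⟨1, Subgroup.one_mem _, fun h ↦ absurd h h1, fun h ↦ absurd h h2⟩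
  obtain ⟨ρ, hρT, hρ1, hρ2⟩ := hρex
  -- ### Steps C–G with the family `(κ₁, κ₂)`
  obtain ⟨B₀, hB₀⟩ := exists_gt_hasGoodReductionAt W
  obtain ⟨ℓ, hbℓ, hℓ, hℓN, hℓD, hℓ2, hprime, h32, g, hg, hgT', hloc⟩ :=
    exists_kolyvaginPrime_gt_of_galoisElement_of_le (W := W) (N := N)
      Automorphic.chebotarev_artinRep_of_galoisSide hK hp hMM' hc₀ ht hinv ![κ₁, κ₂] hρT (max b B₀)
  have hbℓ' : b < ℓ := lt_of_le_of_lt (le_max_left _ _) hbℓ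
  have hidx : M' ≤ Zhang2014.kolyvaginIndex W 2 ℓ :=
    le_kolyvaginIndex_of_frobEqFrobInfty hM' hℓ hℓ2 h32
      (hB₀ ℓ hℓ (lt_of_le_of_lt (le_max_right _ _) hbℓ))
  have hkoly : Zhang2014.IsKolyvaginPrime N W K 2 ℓ :=
    ⟨hℓ, hℓN, hℓD, hℓ2, hprime, lt_of_lt_of_le (by omega) hidx⟩
  have hρg : ρ * g ∈ G := mul_mem hρT hgT'
  have hF : ht.conjGalCMH (ρ * g) * (ρ * g) ∈ torsionFixing (W.baseChange K) ((2 ^ M : ℕ) : ℤ) :=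
    mul_mem (ht.conjGalCMH_mem_torsionFixing W hinv _ (hle hρg)) (hle hρg)
  have hcl : ∀ (i : Fin 2) (j : ℕ), ((2 ^ j : ℕ) : ℤ) • ![κ₁, κ₂] i ∈
      AddSubgroup.closure (Set.range ![κ₁, κ₂]) := fun i j ↦
    AddSubgroup.zsmul_mem _ (AddSubgroup.subset_closure (Set.mem_range.mpr ⟨i, rfl⟩)) _
  -- the local statement for each class
  have key : ∀ (i : Fin 2) (ε : ℤ) (hε : ε = 1 ∨ ε = -1) (hκ : conjAct W c ((2 ^ M : ℕ) : ℤ) (![κ₁, κ₂] i) = ε • ![κ₁, κ₂] i)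
      (m : ℕ) (Z : Subgroup (absoluteGaloisGroup K)),
      (∀ g ∈ torsionFixing (W.baseChange K) ((2 ^ M : ℕ) : ℤ), g ∈ Z ↔ (2 : ℤ) ^ (m - 3) •
        (ε • ht.torsionMap W ((2 ^ M : ℕ) : ℤ) (h1Eval (W.baseChange K) ((2 ^ M : ℕ) : ℤ) (![κ₁, κ₂] i) g) +
          h1Eval (W.baseChange K) ((2 ^ M : ℕ) : ℤ) (![κ₁, κ₂] i) g) = 0) →
      (3 ≤ m → ρ ∉ Z) →
      ∀ v : HeightOneSpectrum (𝓞 K), (ℓ : 𝓞 K) ∈ v.asIdeal → ∀ j : ℕ, j + 3 ≤ m →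
        ((2 ^ j : ℕ) : ℤ) • ![κ₁, κ₂] i ∉
          (W.baseChange K).torsionLocalKer (v.adicCompletion K) ((2 ^ M : ℕ) : ℤ) := by
    intro i ε hε hκ m Z hZ hρZ v hv j hj hmem
    have h0 := (hloc _ (hcl i j) v hv).mp hmem
    rw [h1Eval_zsmul _ _ _ _ hF,
      h1Eval_conjGalCMH_mul_mul_of_eigen W ht hinv _ hε hκ (hle hρT) (hle hgT') (hg.2 i)] at h0
    apply hρZ (by omega)
    rw [hZ ρ (hle hρT)]
    have e : m - 3 = (m - 3 - j) + j := by omega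
    rw [e, pow_add, mul_smul]
    have h0' : (2 : ℤ) ^ j • (ε • ht.torsionMap W ((2 ^ M : ℕ) : ℤ) (h1Eval (W.baseChange K) ((2 ^ M : ℕ) : ℤ) (![κ₁, κ₂] i) ρ) +
        h1Eval (W.baseChange K) ((2 ^ M : ℕ) : ℤ) (![κ₁, κ₂] i) ρ) = 0 := by exact_mod_cast h0
    rw [h0', smul_zero]
  refine ⟨ℓ, hbℓ', hkoly, hidx, h32, fun v hv ↦ ⟨?_, ?_⟩⟩
  · exact key 0 ε₁ hε₁ hκ₁ m₁ Z₁ hZ₁ hρ1 v hv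
  · exact key 1 ε₂ hε₂ hκ₂ m₂ Z₂ hZ₂ hρ2 v hv


end Pair

end Summit.BirchSwinnertonDyer.BirchSwinnertonDyer.Theorems.KolyvaginLowerBoundAtTwo

end
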